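import Summits.CriticalPhenomena.PercolationContinuityZ3.Theorems.Transplant.FKConnectivityAllQAntipodalRootForm3Glue
import Summits.CriticalPhenomena.PercolationContinuityZ3.Theorems.Transplant.FKConnectivityAllQAntipodalRootForm3Attach
import Summits.CriticalPhenomena.PercolationContinuityZ3.Theorems.Transplant.FKConnectivityAllQAntipodalRootForm3Host
import Summits.CriticalPhenomena.PercolationContinuityZ3.Theorems.Transplant.FKConnectivityAllQSPParSplit

/-!
# Connectivity correlation inequalities for `φ_{w,q}`, every `q > 0` — ROOT-FORM CALCULUS, file 74f: **`T2⁺` ON EVERY PARALLEL-SPLIT HOST**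
# (the five facts for the real three-special environment of every `FK.IsParSplit` network, by induction; the `q`-free `T2_x` inequality)

Support file (`--supports stmt-CriticalPhenomena-4575`), FK sub-lane `prim-bschramm-fk-2` (gen 32); builds on p205010 (kernel theorem,
internal audit signed; external expert review pending).  No definitions, no named facts, no sorries; standard axioms.  Memo
FROM-fk-2-g31-DUALITY.md §1/§6 (G4), FROM-fk-2-g32-*.md; FK-Q2 §41.  This is file 61z (`isTTSP_realEnv_facts`, `maj3_levels_le_nonpos_of_isTTSP`)
for three specials.

`𝓔` two-terminal series–parallel between `a, b` whose FIRST node separating the specials `y, z, w` is PARALLEL (`FK.IsParSplit 𝓔 a b {y,z,w}`,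
file 71d).  Induction along `IsParSplit`: the base (a parallel composition `E₁ ∥ E₂` with the specials split 2+1) is file 74d
(`realEnv3_par21_facts` = the kernel-checked GLUE(2,1)∥ certificate + files 73e/74c/74p) in the six placements of `y, z, w` (files 74e
`realEnv3_facts_of_swap/rot` put the specials in order); the four attachment steps are `realEnv3_attP_facts` / `realEnv3_attS_facts` (file 74e, on
the generic engine 61δ–61η).  Hence `isParSplit_realEnv3_facts` (the five facts in every cell) and, by the root identity of file 74b,
**`t2_levels_le_nonpos_of_isParSplit`**: for the host `H = x ∥ 𝓔` (`x = ab ∉ 𝓔`), every cell `(M, C)` of `𝓔 \ {y,z,w}`, every increasing `g`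
blind to `x, y, z, w` and every level `J`, the level-`J` partial sum of the antipodal form of `T2_x = ω_x(ω_y ∨ ω_z ∨ ω_w) ∨ ω_yω_zω_w` against `g`
is `≤ 0` — Conjecture `T2⁺` / `C_∞⁺` at level 4 for the serq type on these hosts (the series-split hosts follow by planar duality, file 74g).
[cite: Grimmett2006, §1.4 eq. (1.20) (p. 15); §3.8 Thm. (3.90) (pp. 61–62); §3.9 (pp. 63–64)] [cite: Wagner2006, Thm. 5.8(d), §5.3]
-/

noncomputable section

namespace Summit.CriticalPhenomena.PercolationContinuityZ3.Theorems

namespace FK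

namespace RootForm

open SimpleGraph Finset Literature.Probability.LatticeModels Literature.Probability.Percolation
open scoped Classical

variable {V : Type*} [Fintype V]

section Cells

variable {E P M : Finset (Sym2 V)} {y z w : Sym2 V}

omit [Fintype V] in
/-- unpacking a cell hypothesis. [folklore] -/
theorem cell₃_off (hM : M ⊆ ((E.erase y).erase z).erase w) : y ∉ M ∧ z ∉ M ∧ w ∉ M ∧ M ⊆ E :=
  ⟨fun h => (Finset.mem_erase.1 (Finset.mem_of_mem_erase (Finset.mem_of_mem_erase (hM h)))).1 rfl,
    fun h => (Finset.mem_erase.1 (Finset.mem_of_mem_erase (hM h))).1 rfl, fun h => (Finset.mem_erase.1 (hM h)).1 rfl,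
    hM.trans (((Finset.erase_subset _ _).trans (Finset.erase_subset _ _)).trans (Finset.erase_subset _ _))⟩

omit [Fintype V] in
/-- the trace of a cell on a part is a cell of the part. [folklore] -/
theorem cell₃_inter (hM : M ⊆ ((E.erase y).erase z).erase w) : M ∩ P ⊆ ((P.erase y).erase z).erase w := by
  obtain ⟨hy, hz, hw, -⟩ := cell₃_off hM
  intro e he
  obtain ⟨heM, heP⟩ := Finset.mem_inter.1 he
  exact Finset.mem_erase.2 ⟨fun h => hw (h ▸ heM), Finset.mem_erase.2 ⟨fun h => hz (h ▸ heM), Finset.mem_erase.2 ⟨fun h => hy (h ▸ heM), heP⟩⟩⟩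

omit [Fintype V] in
/-- a two-special cell of a part. [folklore] -/
theorem cell₂_inter (hM : M ⊆ ((E.erase y).erase z).erase w) : M ∩ P ⊆ (P.erase y).erase z ∧ M ∩ P ⊆ (P.erase y).erase w ∧
    M ∩ P ⊆ (P.erase z).erase w := by
  obtain ⟨hy, hz, hw, -⟩ := cell₃_off hM
  refine ⟨fun e he => ?_, fun e he => ?_, fun e he => ?_⟩ <;> obtain ⟨heM, heP⟩ := Finset.mem_inter.1 he
  · exact Finset.mem_erase.2 ⟨fun h => hz (h ▸ heM), Finset.mem_erase.2 ⟨fun h => hy (h ▸ heM), heP⟩⟩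
  · exact Finset.mem_erase.2 ⟨fun h => hw (h ▸ heM), Finset.mem_erase.2 ⟨fun h => hy (h ▸ heM), heP⟩⟩
  · exact Finset.mem_erase.2 ⟨fun h => hw (h ▸ heM), Finset.mem_erase.2 ⟨fun h => hz (h ▸ heM), heP⟩⟩

omit [Fintype V] in
/-- a one-special cell of a part. [folklore] -/
theorem cell₁_inter (hM : M ⊆ ((E.erase y).erase z).erase w) : M ∩ P ⊆ P.erase y ∧ M ∩ P ⊆ P.erase z ∧ M ∩ P ⊆ P.erase w := by
  obtain ⟨hy, hz, hw, -⟩ := cell₃_off hM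
  refine ⟨fun e he => ?_, fun e he => ?_, fun e he => ?_⟩ <;> obtain ⟨heM, heP⟩ := Finset.mem_inter.1 he
  · exact Finset.mem_erase.2 ⟨fun h => hy (h ▸ heM), heP⟩
  · exact Finset.mem_erase.2 ⟨fun h => hz (h ▸ heM), heP⟩
  · exact Finset.mem_erase.2 ⟨fun h => hw (h ▸ heM), heP⟩

end Cells

section Induction

/-- **The five facts for the real three-special environment of every parallel-split network, in every cell.**
[cite: Grimmett2006, §3.8 Thm. (3.90) (pp. 61–62); §3.9 (pp. 63–64)] [cite: Wagner2006, Thm. 5.8(d), §5.3] -/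
theorem isParSplit_realEnv3_facts {E S : Finset (Sym2 V)} {a b : V} (hE : IsParSplit E a b S) :
    ∀ {uy vy uz vz uw vw : V}, S = {s(uy, vy), s(uz, vz), s(uw, vw)} → s(uy, vy) ∈ E → s(uz, vz) ∈ E → s(uw, vw) ∈ E →
    s(uy, vy) ≠ s(uz, vz) → s(uy, vy) ≠ s(uw, vw) → s(uz, vz) ≠ s(uw, vw) →
    ∀ {M C : Finset (Sym2 V)}, M ⊆ ((E.erase s(uy, vy)).erase s(uz, vz)).erase s(uw, vw) → C ⊆ ((E.erase s(uy, vy)).erase s(uz, vz)).erase s(uw, vw) → Disjoint M C →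
    (∀ h0 h1 : ↥M.powerset → ℝ, Monotone h0 → Monotone h1 → (∀ γ, 0 ≤ h0 γ) → (∀ γ, h0 γ ≤ h1 γ) → ∀ J : ℤ,
        0 ≤ Gen.gMt (realEnv3 M C a b s(uy, vy) s(uz, vz) s(uw, vw)) h0 h1 J)
      ∧ (∀ h0 h1 : Bool × ↥M.powerset → ℝ, Monotone h0 → Monotone h1 → (∀ p, 0 ≤ h0 p) → (∀ p, h0 p ≤ h1 p) → ∀ J : ℤ,
        0 ≤ Gen.gMt (Gen.parE (realEnv3 M C a b s(uy, vy) s(uz, vz) s(uw, vw))) h0 h1 J)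
      ∧ (∀ h : ↥M.powerset → ℝ, Monotone h → (∀ γ, 0 ≤ h γ) → ∀ J : ℤ, 0 ≤ ∑ γ, h γ * (realEnv3 M C a b s(uy, vy) s(uz, vz) s(uw, vw) γ).gandDel J)
      ∧ (∀ h : ↥M.powerset → ℝ, Monotone h → (∀ γ, 0 ≤ h γ) → ∀ J : ℤ, 0 ≤ ∑ γ, h γ * (realEnv3 M C a b s(uy, vy) s(uz, vz) s(uw, vw) γ).gandCon J)
      ∧ (∀ h0 h1 : ↥M.powerset → ℝ, Monotone h0 → Monotone h1 → (∀ γ, 0 ≤ h0 γ) → (∀ γ, h0 γ ≤ h1 γ) → ∀ J : ℤ,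
          0 ≤ ∑ γ, (h1 γ * (realEnv3 M C a b s(uy, vy) s(uz, vz) s(uw, vw) γ).gandE1 J + h0 γ * (realEnv3 M C a b s(uy, vy) s(uz, vz) s(uw, vw) γ).gandE2 J)) := by
  induction hE with
  | @base E₁ E₂ s t S h₁ h₂ hd hV hS₁ hS₂ =>
    intro uy vy uz vz uw vw hS hy hz hw hyz hyw hzw M C hM hC hMC
    subst hS
    obtain ⟨-, -, -, hMe⟩ := cell₃_off hM
    obtain ⟨-, -, -, hCe⟩ := cell₃_off hC
    have hV' : ∀ v : V, (∃ e ∈ E₂, v ∈ e) → (∃ e ∈ E₁, v ∈ e) → v = s ∨ v = t := fun v h2 h1 => hV v h1 h2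
    have dMC : ∀ P : Finset (Sym2 V), Disjoint (M ∩ P) (C ∩ P) :=
      fun P => Finset.disjoint_of_subset_left Finset.inter_subset_left (Finset.disjoint_of_subset_right Finset.inter_subset_left hMC)
    have eM : M ∩ E₁ ∪ M ∩ E₂ = M := by rw [← Finset.inter_union_distrib_left, Finset.inter_eq_left.2 hMe]
    have eC : C ∩ E₁ ∪ C ∩ E₂ = C := by rw [← Finset.inter_union_distrib_left, Finset.inter_eq_left.2 hCe]
    have eM' : M ∩ E₂ ∪ M ∩ E₁ = M := by rw [Finset.union_comm, eM]
    have eC' : C ∩ E₂ ∪ C ∩ E₁ = C := by rw [Finset.union_comm, eC]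
    obtain ⟨m1yz, m1yw, m1zw⟩ := cell₂_inter (P := E₁) hM
    obtain ⟨c1yz, c1yw, c1zw⟩ := cell₂_inter (P := E₁) hC
    obtain ⟨m2yz, m2yw, m2zw⟩ := cell₂_inter (P := E₂) hM
    obtain ⟨c2yz, c2yw, c2zw⟩ := cell₂_inter (P := E₂) hC
    obtain ⟨m1y, m1z, m1w⟩ := cell₁_inter (P := E₁) hM
    obtain ⟨c1y, c1z, c1w⟩ := cell₁_inter (P := E₁) hC
    obtain ⟨m2y, m2z, m2w⟩ := cell₁_inter (P := E₂) hM
    obtain ⟨c2y, c2z, c2w⟩ := cell₁_inter (P := E₂) hC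
    -- no part contains all three specials
    have not1 : ¬ (s(uy, vy) ∈ E₁ ∧ s(uz, vz) ∈ E₁ ∧ s(uw, vw) ∈ E₁) := by
      rintro ⟨h1, h2, h3⟩
      obtain ⟨e, he⟩ := hS₂
      obtain ⟨heS, he2⟩ := Finset.mem_inter.1 he
      simp only [Finset.mem_insert, Finset.mem_singleton] at heS
      rcases heS with rfl | rfl | rfl
      · exact Finset.disjoint_left.1 hd h1 he2
      · exact Finset.disjoint_left.1 hd h2 he2
      · exact Finset.disjoint_left.1 hd h3 he2
    have not2 : ¬ (s(uy, vy) ∈ E₂ ∧ s(uz, vz) ∈ E₂ ∧ s(uw, vw) ∈ E₂) := by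
      rintro ⟨h1, h2, h3⟩
      obtain ⟨e, he⟩ := hS₁
      obtain ⟨heS, he1⟩ := Finset.mem_inter.1 he
      simp only [Finset.mem_insert, Finset.mem_singleton] at heS
      rcases heS with rfl | rfl | rfl
      · exact Finset.disjoint_left.1 hd he1 h1
      · exact Finset.disjoint_left.1 hd he1 h2
      · exact Finset.disjoint_left.1 hd he1 h3
    rcases Finset.mem_union.1 hy with hy1 | hy2 <;> rcases Finset.mem_union.1 hz with hz1 | hz2 <;>
      rcases Finset.mem_union.1 hw with hw1 | hw2
    · exact absurd ⟨hy1, hz1, hw1⟩ not1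
    · -- `y, z ∈ E₁`, `w ∈ E₂`
      have key := realEnv3_par21_facts h₁ h₂ hd hV hy1 hz1 hw2 hyz m1yz c1yz (dMC E₁) m2w c2w (dMC E₂)
      rw [eM, eC] at key; exact key
    · -- `y, w ∈ E₁`, `z ∈ E₂`
      have key := realEnv3_par21_facts h₁ h₂ hd hV hy1 hw1 hz2 hyw m1yw c1yw (dMC E₁) m2z c2z (dMC E₂)
      rw [eM, eC] at key; exact realEnv3_facts_of_swap key
    · -- `y ∈ E₁`, `z, w ∈ E₂`
      have key := realEnv3_par21_facts h₂ h₁ hd.symm hV' hz2 hw2 hy1 hzw m2zw c2zw (dMC E₂) m1y c1y (dMC E₁)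
      rw [eM', eC'] at key; exact realEnv3_facts_of_rot key
    · -- `z, w ∈ E₁`, `y ∈ E₂`
      have key := realEnv3_par21_facts h₁ h₂ hd hV hz1 hw1 hy2 hzw m1zw c1zw (dMC E₁) m2y c2y (dMC E₂)
      rw [eM, eC] at key; exact realEnv3_facts_of_rot key
    · -- `z ∈ E₁`, `y, w ∈ E₂`
      have key := realEnv3_par21_facts h₂ h₁ hd.symm hV' hy2 hw2 hz1 hyw m2yw c2yw (dMC E₂) m1z c1z (dMC E₁)
      rw [eM', eC'] at key; exact realEnv3_facts_of_swap key
    · -- `w ∈ E₁`, `y, z ∈ E₂`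
      have key := realEnv3_par21_facts h₂ h₁ hd.symm hV' hy2 hz2 hw1 hyz m2yz c2yz (dMC E₂) m1w c1w (dMC E₁)
      rw [eM', eC'] at key; exact key
    · exact absurd ⟨hy2, hz2, hw2⟩ not2
  | @series_left E₁ E₂ a m b S h₁ h₂ hd hV ha hb hS ih =>
    intro uy vy uz vz uw vw hSe hy hz hw hyz hyw hzw M C hM hC hMC
    subst hSe
    obtain ⟨-, -, -, hMe⟩ := cell₃_off hM
    obtain ⟨-, -, -, hCe⟩ := cell₃_off hC
    have sy : s(uy, vy) ∉ E₂ := Finset.disjoint_left.1 hS (by simp)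
    have sz : s(uz, vz) ∉ E₂ := Finset.disjoint_left.1 hS (by simp)
    have sw : s(uw, vw) ∉ E₂ := Finset.disjoint_left.1 hS (by simp)
    have hy1 : s(uy, vy) ∈ E₁ := (Finset.mem_union.1 hy).resolve_right sy
    have hz1 : s(uz, vz) ∈ E₁ := (Finset.mem_union.1 hz).resolve_right sz
    have hw1 : s(uw, vw) ∈ E₁ := (Finset.mem_union.1 hw).resolve_right sw
    have ham : a ≠ m := h₁.isTTSP.ne
    have hbm : b ≠ m := h₂.ne.symm
    have hab : a ≠ b := by obtain ⟨e, he, hae⟩ := h₁.isTTSP.left_mem; exact fun h => hb e he (h ▸ hae)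
    have hV' : ∀ v : V, (∃ e ∈ E₂, v ∈ e) → (∃ e ∈ E₁, v ∈ e) → v = m := fun v h2 h1 => hV v h1 h2
    have dMC : ∀ P : Finset (Sym2 V), Disjoint (M ∩ P) (C ∩ P) :=
      fun P => Finset.disjoint_of_subset_left Finset.inter_subset_left (Finset.disjoint_of_subset_right Finset.inter_subset_left hMC)
    have inner := ih rfl hy1 hz1 hw1 hyz hyw hzw (cell₃_inter hM) (cell₃_inter hC) (dMC E₁)
    rw [realEnv3_pole_comm] at inner
    have key := realEnv3_attS_facts (MA := M ∩ E₂) (CA := C ∩ E₂) (M := M ∩ E₁) (C := C ∩ E₁) h₂.symm hd.symm hV' hb ha hbm ham hab.symm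
      Finset.inter_subset_right Finset.inter_subset_right
      (Finset.insert_subset hy1 (Finset.insert_subset hz1 (Finset.insert_subset hw1 Finset.inter_subset_right))) Finset.inter_subset_right inner
    rw [realEnv3_pole_comm] at key
    have eM : M ∩ E₂ ∪ M ∩ E₁ = M := by rw [← Finset.inter_union_distrib_left, Finset.union_comm, Finset.inter_eq_left.2 hMe]
    have eC : C ∩ E₂ ∪ C ∩ E₁ = C := by rw [← Finset.inter_union_distrib_left, Finset.union_comm, Finset.inter_eq_left.2 hCe]
    rw [eM, eC] at key; exact key
  | @series_right E₁ E₂ a m b S h₁ h₂ hd hV ha hb hS ih =>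
    intro uy vy uz vz uw vw hSe hy hz hw hyz hyw hzw M C hM hC hMC
    subst hSe
    obtain ⟨-, -, -, hMe⟩ := cell₃_off hM
    obtain ⟨-, -, -, hCe⟩ := cell₃_off hC
    have sy : s(uy, vy) ∉ E₁ := Finset.disjoint_left.1 hS (by simp)
    have sz : s(uz, vz) ∉ E₁ := Finset.disjoint_left.1 hS (by simp)
    have sw : s(uw, vw) ∉ E₁ := Finset.disjoint_left.1 hS (by simp)
    have hy2 : s(uy, vy) ∈ E₂ := (Finset.mem_union.1 hy).resolve_left sy
    have hz2 : s(uz, vz) ∈ E₂ := (Finset.mem_union.1 hz).resolve_left sz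
    have hw2 : s(uw, vw) ∈ E₂ := (Finset.mem_union.1 hw).resolve_left sw
    have ham : a ≠ m := h₁.ne
    have hbm : b ≠ m := h₂.isTTSP.ne.symm
    have hab : a ≠ b := by obtain ⟨e, he, hae⟩ := h₁.left_mem; exact fun h => hb e he (h ▸ hae)
    have dMC : ∀ P : Finset (Sym2 V), Disjoint (M ∩ P) (C ∩ P) :=
      fun P => Finset.disjoint_of_subset_left Finset.inter_subset_left (Finset.disjoint_of_subset_right Finset.inter_subset_left hMC)
    have inner := ih rfl hy2 hz2 hw2 hyz hyw hzw (cell₃_inter hM) (cell₃_inter hC) (dMC E₂)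
    have key := realEnv3_attS_facts (MA := M ∩ E₁) (CA := C ∩ E₁) (M := M ∩ E₂) (C := C ∩ E₂) h₁ hd hV ha hb ham hbm hab
      Finset.inter_subset_right Finset.inter_subset_right
      (Finset.insert_subset hy2 (Finset.insert_subset hz2 (Finset.insert_subset hw2 Finset.inter_subset_right))) Finset.inter_subset_right inner
    have eM : M ∩ E₁ ∪ M ∩ E₂ = M := by rw [← Finset.inter_union_distrib_left, Finset.inter_eq_left.2 hMe]
    have eC : C ∩ E₁ ∪ C ∩ E₂ = C := by rw [← Finset.inter_union_distrib_left, Finset.inter_eq_left.2 hCe]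
    rw [eM, eC] at key; exact key
  | @parallel_left E₁ E₂ s t S h₁ h₂ hd hV hS ih =>
    intro uy vy uz vz uw vw hSe hy hz hw hyz hyw hzw M C hM hC hMC
    subst hSe
    obtain ⟨-, -, -, hMe⟩ := cell₃_off hM
    obtain ⟨-, -, -, hCe⟩ := cell₃_off hC
    have sy : s(uy, vy) ∉ E₂ := Finset.disjoint_left.1 hS (by simp)
    have sz : s(uz, vz) ∉ E₂ := Finset.disjoint_left.1 hS (by simp)
    have sw : s(uw, vw) ∉ E₂ := Finset.disjoint_left.1 hS (by simp)
    have hy1 : s(uy, vy) ∈ E₁ := (Finset.mem_union.1 hy).resolve_right sy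
    have hz1 : s(uz, vz) ∈ E₁ := (Finset.mem_union.1 hz).resolve_right sz
    have hw1 : s(uw, vw) ∈ E₁ := (Finset.mem_union.1 hw).resolve_right sw
    have hV' : ∀ v : V, (∃ e ∈ E₂, v ∈ e) → (∃ e ∈ E₁, v ∈ e) → v = s ∨ v = t := fun v h2 h1 => hV v h1 h2
    have dMC : ∀ P : Finset (Sym2 V), Disjoint (M ∩ P) (C ∩ P) :=
      fun P => Finset.disjoint_of_subset_left Finset.inter_subset_left (Finset.disjoint_of_subset_right Finset.inter_subset_left hMC)
    have inner := ih rfl hy1 hz1 hw1 hyz hyw hzw (cell₃_inter hM) (cell₃_inter hC) (dMC E₁)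
    have key := realEnv3_attP_facts (MA := M ∩ E₂) (CA := C ∩ E₂) (M := M ∩ E₁) (C := C ∩ E₁) h₂ hd.symm hV'
      Finset.inter_subset_right Finset.inter_subset_right
      (Finset.insert_subset hy1 (Finset.insert_subset hz1 (Finset.insert_subset hw1 Finset.inter_subset_right))) Finset.inter_subset_right inner
    have eM : M ∩ E₂ ∪ M ∩ E₁ = M := by rw [← Finset.inter_union_distrib_left, Finset.union_comm, Finset.inter_eq_left.2 hMe]
    have eC : C ∩ E₂ ∪ C ∩ E₁ = C := by rw [← Finset.inter_union_distrib_left, Finset.union_comm, Finset.inter_eq_left.2 hCe]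
    rw [eM, eC] at key; exact key
  | @parallel_right E₁ E₂ s t S h₁ h₂ hd hV hS ih =>
    intro uy vy uz vz uw vw hSe hy hz hw hyz hyw hzw M C hM hC hMC
    subst hSe
    obtain ⟨-, -, -, hMe⟩ := cell₃_off hM
    obtain ⟨-, -, -, hCe⟩ := cell₃_off hC
    have sy : s(uy, vy) ∉ E₁ := Finset.disjoint_left.1 hS (by simp)
    have sz : s(uz, vz) ∉ E₁ := Finset.disjoint_left.1 hS (by simp)
    have sw : s(uw, vw) ∉ E₁ := Finset.disjoint_left.1 hS (by simp)
    have hy2 : s(uy, vy) ∈ E₂ := (Finset.mem_union.1 hy).resolve_left sy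
    have hz2 : s(uz, vz) ∈ E₂ := (Finset.mem_union.1 hz).resolve_left sz
    have hw2 : s(uw, vw) ∈ E₂ := (Finset.mem_union.1 hw).resolve_left sw
    have dMC : ∀ P : Finset (Sym2 V), Disjoint (M ∩ P) (C ∩ P) :=
      fun P => Finset.disjoint_of_subset_left Finset.inter_subset_left (Finset.disjoint_of_subset_right Finset.inter_subset_left hMC)
    have inner := ih rfl hy2 hz2 hw2 hyz hyw hzw (cell₃_inter hM) (cell₃_inter hC) (dMC E₂)
    have key := realEnv3_attP_facts (MA := M ∩ E₁) (CA := C ∩ E₁) (M := M ∩ E₂) (C := C ∩ E₂) h₁ hd hV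
      Finset.inter_subset_right Finset.inter_subset_right
      (Finset.insert_subset hy2 (Finset.insert_subset hz2 (Finset.insert_subset hw2 Finset.inter_subset_right))) Finset.inter_subset_right inner
    have eM : M ∩ E₁ ∪ M ∩ E₂ = M := by rw [← Finset.inter_union_distrib_left, Finset.inter_eq_left.2 hMe]
    have eC : C ∩ E₁ ∪ C ∩ E₂ = C := by rw [← Finset.inter_union_distrib_left, Finset.inter_eq_left.2 hCe]
    rw [eM, eC] at key; exact key

end Induction

section Main

variable {E M C : Finset (Sym2 V)} {a b uy vy uz vz uw vw : V}

/-- **THEOREM (`T2⁺` on every parallel-split host: the `q`-free `T2_x` inequality).**  Let `𝓔` be two-terminal series–parallel between `a, b`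
with `x = ab ∉ 𝓔` (so `H = 𝓔 ∪ {x}` is a 2-connected series–parallel graph presented from its edge `x`), let `y, z, w ∈ 𝓔` be three further
distinct special edges whose first separating node in `𝓔` is parallel (`FK.IsParSplit 𝓔 a b {y,z,w}`), and `(M, C)` any cell inside
`𝓔 \ {y,z,w}` (free / contracted, disjoint; `x, y, z, w` free).  Then for every increasing `g` blind to `x, y, z, w` and every level `J`:
`Σ_{γ ⊆ M ∪ {x,y,z,w} : k(γ∪C)+k(γᶜ∪C) ≤ J} (T2_x(γ∪C) − T2_x(γᶜ∪C))·(g(γ∪C) − g(γᶜ∪C)) ≤ 0`,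
`T2_x = 1{(x ∧ (y ∨ z ∨ w)) ∨ (y ∧ z ∧ w)}` (ray 19 of the level-4 odd cone): every coefficient — in the edge odds and in `q` — of
`Z_H(z,q)² Cov_{φ_{z,q}}(T2_x, g)/(q − 1)` on this cell is nonnegative.  Proof: root identity (file 74b) + `isParSplit_realEnv3_facts`.
[cite: Grimmett2006, §1.4 eq. (1.20) (p. 15); §3.8 Thm. (3.90) (pp. 61–62); §3.9 (pp. 63–64)] [cite: Wagner2006, Thm. 5.8(d), §5.3] -/
theorem t2_levels_le_nonpos_of_isParSplit (hE : IsParSplit E a b {s(uy, vy), s(uz, vz), s(uw, vw)}) (hx : s(a, b) ∉ E)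
    (hy : s(uy, vy) ∈ E) (hz : s(uz, vz) ∈ E) (hw : s(uw, vw) ∈ E) (hyz : s(uy, vy) ≠ s(uz, vz)) (hyw : s(uy, vy) ≠ s(uw, vw)) (hzw : s(uz, vz) ≠ s(uw, vw))
    (hM : M ⊆ ((E.erase s(uy, vy)).erase s(uz, vz)).erase s(uw, vw)) (hC : C ⊆ ((E.erase s(uy, vy)).erase s(uz, vz)).erase s(uw, vw)) (hMC : Disjoint M C)
    {g : Finset (Sym2 V) → ℝ} (hgx : ∀ A : Finset (Sym2 V), g (insert s(a, b) A) = g A)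
    (hgy : ∀ A : Finset (Sym2 V), g (insert s(uy, vy) A) = g A) (hgz : ∀ A : Finset (Sym2 V), g (insert s(uz, vz) A) = g A)
    (hgw : ∀ A : Finset (Sym2 V), g (insert s(uw, vw) A) = g A)
    (hmono : ∀ ⦃X Y : Finset (Sym2 V)⦄, X ⊆ Y → g X ≤ g Y) (J : ℕ) :
    ∑ γ ∈ (insert s(a, b) (insert s(uy, vy) (insert s(uz, vz) (insert s(uw, vw) M)))).powerset with
        apExpC (insert s(a, b) (insert s(uy, vy) (insert s(uz, vz) (insert s(uw, vw) M)))) C γ ≤ J,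
        ((((fun X : Finset (Sym2 V) => if (s(a, b) ∈ X ∧ (s(uy, vy) ∈ X ∨ s(uz, vz) ∈ X ∨ s(uw, vw) ∈ X)) ∨ (s(uy, vy) ∈ X ∧ s(uz, vz) ∈ X ∧ s(uw, vw) ∈ X)
              then (1 : ℝ) else 0) (γ ∪ C)) -
            ((fun X : Finset (Sym2 V) => if (s(a, b) ∈ X ∧ (s(uy, vy) ∈ X ∨ s(uz, vz) ∈ X ∨ s(uw, vw) ∈ X)) ∨ (s(uy, vy) ∈ X ∧ s(uz, vz) ∈ X ∧ s(uw, vw) ∈ X)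
              then (1 : ℝ) else 0) ((insert s(a, b) (insert s(uy, vy) (insert s(uz, vz) (insert s(uw, vw) M)))) \ γ ∪ C))) *
          (g (γ ∪ C) - g ((insert s(a, b) (insert s(uy, vy) (insert s(uz, vz) (insert s(uw, vw) M)))) \ γ ∪ C))) ≤ 0 := by
  obtain ⟨hyM, hzM, hwM, hMe⟩ := cell₃_off hM
  obtain ⟨hyC, hzC, hwC, hCe⟩ := cell₃_off hC
  exact t2_levels_le_nonpos_of_rootFact3 (fun h => hx (hMe h)) hyM hzM hwM (fun h => hx (hCe h)) hyC hzC hwC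
    (fun h => hx (h ▸ hy)) (fun h => hx (h ▸ hz)) (fun h => hx (h ▸ hw)) hyz hyw hzw
    (fun h mh nh J => (isParSplit_realEnv3_facts hE rfl hy hz hw hyz hyw hzw hM hC hMC).1 h h mh mh nh (fun _ => le_rfl) J)
    hgx hgy hgz hgw hmono J

end Main

end RootForm

end FK

end Summit.CriticalPhenomena.PercolationContinuityZ3.Theorems

end
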